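import Mathlib.Analysis.Calculus.ContDiff.Bounds
import Mathlib.Analysis.SpecialFunctions.Pow.Deriv
import Mathlib.Analysis.Asymptotics.Lemmas
import Literature.Analysis.Calculus.FlatCubeRootDescent
import HarnessLib

/-!
# Flat real cube-root descent with parameters, I: branches and the key decay estimate

Topic `Analysis/Calculus`; cell `pub/hodgecm-mathlib`, N8-INNER brick (10)(A) «SPLIT NEWTON `S₂ ⊂ S₃`» (sigsheet
`SIGSHEET-NewtonSplitThree.v1`, file F1 part I).  Count-neutral Literature THEOREMS (`--kind proof --supports
stmt-HodgeConjecture-24833`); no `def`, no instance, no notation, no `sorry`.  The one-real-variable twin of ★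
`FlatCubeRootDescent` (`s ↦ s³` on `ℝ` instead of `w ↦ w³` on `ℂ`), same frame (one universe, `P` finite-dimensional
where compactness is used, `E` any real normed space).  §1: the two smooth branches `S^{1/3}` (`S > 0`) and
`−(−S)^{1/3}` (`S < 0`); set-theoretic descent `f (s, y) = K (s³, y)` (cubing is injective), `K` smooth off the
zero section; uniform flatness constants.  §2: the KEY DECAY ESTIMATE `tendsto_iteratedFDeriv_of_comp_pow_three_eq` —
if `f` is flat along `{0} × P` then every iterated derivative of `K` tends to `0` at the section from the off-section
side (dyadic shells `8^{-m} < |S| ≤ 8^{1-m}` dilated to the fixed shells `1 ≤ ±S ≤ 8`; Mathlib's chain-rule bound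
`norm_iteratedFDerivWithin_comp_le`; branch constant by compactness, flatness constant `C (2·2^{-m})^{3n+1}`).
Part II (`FlatCubeRootDescentReal`) draws the heads `f (s, y) = G (s³, y)` and the «mod 3» decomposition.
HONEST LABEL: count-neutral Mathlib-side analysis; HC_CM is proved only modulo the printed citations (hLiu418 =
`stmt-HodgeConjecture-24832`, h413 = `stmt-HodgeConjecture-24833`) until rung 0 closes.

## References
* [Whitney1943] H. Whitney, *Differentiable even functions*, Duke Math. J. 10 (1943) 159–160, Thm. 1.
* [HormanderALPDO1] L. Hörmander, *The Analysis of Linear Partial Differential Operators I*, §1.1 (1.1.7)–(1.1.8).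
-/

noncomputable section

open Set Function Filter Metric Topology Asymptotics
open scoped ContDiff Nat

namespace Literature.Analysis.Calculus

universe u

/-! ## §1 The real cube root and the descended function -/

section CubeRoot

variable {P : Type u} [NormedAddCommGroup P] [NormedSpace ℝ P]
  {E : Type u} [NormedAddCommGroup E] [NormedSpace ℝ E]

/-- Cubing is injective on `ℝ`. [folklore] [cite: Whitney1943, Thm. 1] -/
theorem pow_three_injective : Function.Injective fun s : ℝ => s ^ 3 :=
  (Odd.strictMono_pow (by decide : Odd 3)).injective

/-- The positive branch: `(S ^ (1/3)) ^ 3 = S` on `0 < S` (Mathlib's `Real.rpow_inv_natCast_pow`).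
[folklore] [cite: Whitney1943, Thm. 1] -/
theorem rpow_third_pow_three_of_pos {S : ℝ} (hS : 0 < S) : (S ^ ((3 : ℝ)⁻¹)) ^ 3 = S := by
  simpa using Real.rpow_inv_natCast_pow hS.le (n := 3) (by norm_num)

/-- The negative branch: `(-((-S) ^ (1/3))) ^ 3 = S` on `S < 0`. [folklore] [cite: Whitney1943, Thm. 1] -/
theorem neg_rpow_third_neg_pow_three {S : ℝ} (hS : S < 0) : (-((-S) ^ ((3 : ℝ)⁻¹))) ^ 3 = S := by
  have h := rpow_third_pow_three_of_pos (S := -S) (by linarith)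
  have : (-((-S) ^ ((3 : ℝ)⁻¹))) ^ 3 = -(((-S) ^ ((3 : ℝ)⁻¹)) ^ 3) := by ring
  rw [this, h, neg_neg]

/-- Every real number is a cube, with the cube root `sign S · |S| ^ (1/3)` written by cases.
[folklore] [cite: Whitney1943, Thm. 1] -/
theorem exists_pow_three_eq (S : ℝ) : ∃ s : ℝ, s ^ 3 = S := by
  rcases lt_trichotomy 0 S with h | h | h
  · exact ⟨_, rpow_third_pow_three_of_pos h⟩
  · exact ⟨0, by rw [← h]; norm_num⟩
  · exact ⟨_, neg_rpow_third_neg_pow_three h⟩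

/-- The positive branch is smooth on `S > 0`. [folklore] [cite: Whitney1943, Thm. 1] -/
theorem contDiffAt_rpow_third {S : ℝ} (hS : 0 < S) {n : WithTop ℕ∞} :
    ContDiffAt ℝ n (fun S : ℝ => S ^ ((3 : ℝ)⁻¹)) S :=
  (Real.contDiffAt_rpow_const_of_ne (p := (3 : ℝ)⁻¹) hS.ne').of_le le_top

/-- The negative branch is smooth on `S < 0`. [folklore] [cite: Whitney1943, Thm. 1] -/
theorem contDiffAt_neg_rpow_third_neg {S : ℝ} (hS : S < 0) {n : WithTop ℕ∞} :
    ContDiffAt ℝ n (fun S : ℝ => -((-S) ^ ((3 : ℝ)⁻¹))) S := by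
  have h1 : ContDiffAt ℝ n (fun S : ℝ => (-S) ^ ((3 : ℝ)⁻¹)) S :=
    (contDiffAt_rpow_third (S := -S) (by linarith)).comp S contDiffAt_id.neg
  exact h1.neg

/-- A function on `ℝ × P` descends along `s ↦ s³`: there is `K` with `f (s, y) = K (s³, y)` for ALL `s`, provided
`f` takes equal values at points with equal cubes — which is automatic, cubing being injective. [folklore]
[cite: Whitney1943, Thm. 1] -/
theorem exists_comp_pow_three_eq {α β : Type*} (f : ℝ × β → α) :
    ∃ K : ℝ × β → α, ∀ (s : ℝ) (y : β), f (s, y) = K (s ^ 3, y) := by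
  classical
  refine ⟨fun q => f (Classical.choose (exists_pow_three_eq q.1), q.2), fun s y => ?_⟩
  have h := Classical.choose_spec (exists_pow_three_eq (s ^ 3))
  dsimp only
  rw [pow_three_injective h]

/-- Off the zero section the descended function is locally the composition of `f` with a smooth cube-root branch,
hence `C^∞` there. [folklore] [cite: Whitney1943, Thm. 1] -/
theorem contDiffOn_of_comp_pow_three_eq (f : ℝ × P → E) (hf : ContDiff ℝ ∞ f) (K : ℝ × P → E)
    (hK : ∀ (s : ℝ) (y : P), f (s, y) = K (s ^ 3, y)) :
    ContDiffOn ℝ ∞ K {q : ℝ × P | q.1 ≠ 0} := by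
  intro q hq
  refine ContDiffAt.contDiffWithinAt ?_
  rcases lt_or_gt_of_ne hq with h | h
  · -- negative branch
    have hs : {p : ℝ × P | p.1 < 0} ∈ 𝓝 q := (isOpen_lt continuous_fst continuous_const).mem_nhds h
    have heq : K =ᶠ[𝓝 q] fun p : ℝ × P => f (-((-p.1) ^ ((3 : ℝ)⁻¹)), p.2) := by
      filter_upwards [hs] with p hp
      rw [hK, neg_rpow_third_neg_pow_three hp]
    refine ContDiffAt.congr_of_eventuallyEq ?_ heq
    exact hf.contDiffAt.comp q
      (((contDiffAt_neg_rpow_third_neg h).comp q contDiffAt_fst).prodMk contDiffAt_snd)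
  · have hs : {p : ℝ × P | 0 < p.1} ∈ 𝓝 q := (isOpen_lt continuous_const continuous_fst).mem_nhds h
    have heq : K =ᶠ[𝓝 q] fun p : ℝ × P => f (p.1 ^ ((3 : ℝ)⁻¹), p.2) := by
      filter_upwards [hs] with p hp
      rw [hK, rpow_third_pow_three_of_pos hp]
    refine ContDiffAt.congr_of_eventuallyEq ?_ heq
    exact hf.contDiffAt.comp q
      (((contDiffAt_rpow_third h).comp q contDiffAt_fst).prodMk contDiffAt_snd)

/-- Uniform flatness constants for all derivatives of order `≤ n` near a section point, from jet-flatness (real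
variable). [folklore] [cite: HormanderALPDO1, §1.1 Thm. 1.1.8 ff. (Taylor's formula (1.1.7))] -/
theorem exists_forall_norm_iteratedFDeriv_le_of_flat_real (f : ℝ × P → E) (hf : ContDiff ℝ ∞ f)
    (hflat : ∀ (n : ℕ) (y : P), iteratedFDeriv ℝ n f (0, y) = 0) (n N : ℕ) (y₀ : P) :
    ∃ C δ : ℝ, 0 ≤ C ∧ 0 < δ ∧ ∀ i ≤ n, ∀ q : ℝ × P, dist q (0, y₀) < δ →
      ‖iteratedFDeriv ℝ i f q‖ ≤ C * ‖q.1‖ ^ N := by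
  have h1 : ∀ i : ℕ, ∃ C δ : ℝ, 0 ≤ C ∧ 0 < δ ∧ ∀ q : ℝ × P, dist q (0, y₀) < δ →
      ‖iteratedFDeriv ℝ i f q‖ ≤ C * ‖q.1‖ ^ N := by
    intro i
    obtain ⟨C, hC0, hC⟩ :=
      (isBigO_iteratedFDeriv_norm_fst_pow_of_zeroSection hf hflat i N y₀).exists_nonneg
    rw [Asymptotics.IsBigOWith_def, Metric.eventually_nhds_iff] at hC
    obtain ⟨δ, hδ, h⟩ := hC
    refine ⟨C, δ, hC0, hδ, fun q hq => ?_⟩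
    have := h hq
    rwa [Real.norm_of_nonneg (by positivity)] at this
  choose C δ hC0 hδ hCδ using h1
  refine ⟨∑ i ∈ Finset.range (n + 1), C i, (Finset.range (n + 1)).inf' ⟨0, by simp⟩ δ,
    Finset.sum_nonneg fun i _ => hC0 i, (Finset.lt_inf'_iff _).2 fun i _ => hδ i,
    fun i hi q hq => ?_⟩
  have him : i ∈ Finset.range (n + 1) := Finset.mem_range.2 (Nat.lt_succ_of_le hi)
  have hq' : dist q (0, y₀) < δ i := lt_of_lt_of_le hq (Finset.inf'_le _ him)
  refine (hCδ i q hq').trans ?_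
  gcongr
  exact Finset.single_le_sum (fun j _ => hC0 j) him

end CubeRoot
/-! ## §2 The key decay estimate -/

section Key

variable {P : Type u} [NormedAddCommGroup P] [NormedSpace ℝ P] [FiniteDimensional ℝ P]
  {E : Type u} [NormedAddCommGroup E] [NormedSpace ℝ E]

/-- `|c| ≤ 2` when `|c ^ 3| ≤ 8` (real). [folklore] [cite: Whitney1943, Thm. 1] -/
theorem abs_le_two_of_abs_pow_three_le {c : ℝ} (h : ‖c ^ 3‖ ≤ 8) : ‖c‖ ≤ 2 := by
  rw [norm_pow] at h
  by_contra h'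
  push Not at h'
  have : (2 : ℝ) ^ 3 < ‖c‖ ^ 3 := by gcongr
  linarith

/-- **Key decay estimate for the flat real cube-root descent.** If `f : ℝ × P → E` is smooth with all derivatives
vanishing on `{0} × P` and `f (s, y) = K (s ^ 3, y)`, then every (global) iterated derivative of `K` tends to `0` at
every section point from the off-section side: on the dyadic shell `8^{-m} ≤ |S| ≤ 8^{1-m}` one has
`‖Dⁿ K‖ ≤ A · 2^{-m}` — dilate to the fixed shells `1 ≤ ±S ≤ 8`, where `K` is `f ∘ (2^{-m} • cube-root branch)`, and
let the chain-rule bound meet the flatness bound `‖Dⁱ f (s, y)‖ ≤ C |s| ^ (3n+1)`. (One-real-variable twin of ★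
`FlatCubeRootDescent.tendsto_iteratedFDeriv_of_comp_cube_eq`.) [folklore] [cite: Whitney1943, Thm. 1]
[cite: HormanderALPDO1, §1.1 (1.1.7)–(1.1.8)] -/
theorem tendsto_iteratedFDeriv_of_comp_pow_three_eq (f : ℝ × P → E) (hf : ContDiff ℝ ∞ f)
    (hflat : ∀ (n : ℕ) (y : P), iteratedFDeriv ℝ n f (0, y) = 0) (K : ℝ × P → E)
    (hK : ∀ (s : ℝ) (y : P), f (s, y) = K (s ^ 3, y)) (n : ℕ) (y₀ : P) :
    Tendsto (fun q => iteratedFDeriv ℝ n K q) (𝓝[{q : ℝ × P | q.1 ≠ 0}] (0, y₀)) (𝓝 0) := by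
  -- (1) flatness constants for the orders `≤ n` with `N = 3 n + 1`
  obtain ⟨C, δ, hC0, hδ, hCδ⟩ :=
    exists_forall_norm_iteratedFDeriv_le_of_flat_real f hf hflat n (3 * n + 1) y₀
  -- (2) the two cube-root branches as maps of `ℝ × P`, their open domains and compact shells
  set Ψ₀ : ℝ × P → ℝ × P := fun q => (q.1 ^ ((3 : ℝ)⁻¹), q.2) with hΨ₀
  set Ψ₁ : ℝ × P → ℝ × P := fun q => (-((-q.1) ^ ((3 : ℝ)⁻¹)), q.2) with hΨ₁
  set s₀ : Set (ℝ × P) := {q | 0 < q.1} with hs₀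
  set s₁ : Set (ℝ × P) := {q | q.1 < 0} with hs₁
  have hs₀o : IsOpen s₀ := isOpen_lt continuous_const continuous_fst
  have hs₁o : IsOpen s₁ := isOpen_lt continuous_fst continuous_const
  have hΨ₀s : ContDiffOn ℝ ∞ Ψ₀ s₀ := fun q hq =>
    (((contDiffAt_rpow_third hq).comp q contDiffAt_fst).prodMk contDiffAt_snd).contDiffWithinAt
  have hΨ₁s : ContDiffOn ℝ ∞ Ψ₁ s₁ := fun q hq =>
    (((contDiffAt_neg_rpow_third_neg hq).comp q contDiffAt_fst).prodMk contDiffAt_snd).contDiffWithinAt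
  set Q₀ : Set (ℝ × P) := ({q : ℝ × P | 1 ≤ q.1} ∩ {q | q.1 ≤ 8}) ∩ {q | dist q.2 y₀ ≤ 1} with hQ₀
  set Q₁ : Set (ℝ × P) := ({q : ℝ × P | q.1 ≤ -1} ∩ {q | -8 ≤ q.1}) ∩ {q | dist q.2 y₀ ≤ 1} with hQ₁
  have hQ₀s : Q₀ ⊆ s₀ := fun q ⟨⟨h1, _⟩, _⟩ => by change 1 ≤ q.1 at h1; change 0 < q.1; linarith
  have hQ₁s : Q₁ ⊆ s₁ := fun q ⟨⟨h1, _⟩, _⟩ => by change q.1 ≤ -1 at h1; change q.1 < 0; linarith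
  have hbdd : ∀ Q : Set (ℝ × P), (∀ q ∈ Q, ‖q.1‖ ≤ 8 ∧ dist q.2 y₀ ≤ 1) → Bornology.IsBounded Q := by
    intro Q hQ
    refine (Metric.isBounded_iff_subset_closedBall (0, y₀)).2 ⟨8 + 1, fun q hq => ?_⟩
    obtain ⟨h1, h2⟩ := hQ q hq
    rw [mem_closedBall, Prod.dist_eq]
    refine max_le ?_ (h2.trans (by norm_num))
    rw [dist_zero_right]; linarith
  have hc1 : IsClosed {q : ℝ × P | 1 ≤ q.1} := isClosed_le continuous_const continuous_fst
  have hc2 : IsClosed {q : ℝ × P | q.1 ≤ 8} := isClosed_le continuous_fst continuous_const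
  have hc1' : IsClosed {q : ℝ × P | q.1 ≤ -1} := isClosed_le continuous_fst continuous_const
  have hc2' : IsClosed {q : ℝ × P | -8 ≤ q.1} := isClosed_le continuous_const continuous_fst
  have hc4 : IsClosed {q : ℝ × P | dist q.2 y₀ ≤ 1} :=
    isClosed_le (continuous_snd.dist continuous_const) continuous_const
  have hQ₀c : IsCompact Q₀ :=
    Metric.isCompact_of_isClosed_isBounded ((hc1.inter hc2).inter hc4)
      (hbdd Q₀ fun q ⟨⟨h1, h2⟩, h4⟩ => ⟨by
        change 1 ≤ q.1 at h1; change q.1 ≤ 8 at h2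
        rw [Real.norm_of_nonneg (by linarith)]; exact h2, h4⟩)
  have hQ₁c : IsCompact Q₁ :=
    Metric.isCompact_of_isClosed_isBounded ((hc1'.inter hc2').inter hc4)
      (hbdd Q₁ fun q ⟨⟨h1, h2⟩, h4⟩ => ⟨by
        change q.1 ≤ -1 at h1; change -8 ≤ q.1 at h2
        rw [Real.norm_of_nonpos (by linarith)]; linarith, h4⟩)
  obtain ⟨D₀, hD₀1, hD₀⟩ := exists_forall_norm_iteratedFDerivWithin_le_pow hs₀o hΨ₀s hQ₀c hQ₀s n
  obtain ⟨D₁, hD₁1, hD₁⟩ := exists_forall_norm_iteratedFDerivWithin_le_pow hs₁o hΨ₁s hQ₁c hQ₁s n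
  set D : ℝ := max D₀ D₁ with hD
  have hD1 : 1 ≤ D := hD₀1.trans (le_max_left _ _)
  -- (3) the final constant and the choice of the depth `m₀`
  set A : ℝ := n.factorial * (C * 2 ^ (3 * n + 1)) * D ^ n with hA
  have hA0 : 0 ≤ A := by positivity
  rw [Metric.tendsto_nhdsWithin_nhds]
  intro ε hε
  obtain ⟨m₀, hm₀⟩ := exists_pow_lt_of_lt_one
    (lt_min (div_pos hε (by positivity : (0 : ℝ) < A + 1)) (half_pos hδ))
    (by norm_num : (1 / 2 : ℝ) < 1)
  have hm₀ε : (1 / 2 : ℝ) ^ m₀ < ε / (A + 1) := lt_of_lt_of_le hm₀ (min_le_left _ _)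
  have hm₀δ : (1 / 2 : ℝ) ^ m₀ < δ / 2 := lt_of_lt_of_le hm₀ (min_le_right _ _)
  refine ⟨min (min δ 1) ((1 / 8 : ℝ) ^ m₀), lt_min (lt_min hδ one_pos) (by positivity), ?_⟩
  rintro ⟨w₀, z⟩ hw₀ hdist
  change w₀ ≠ 0 at hw₀
  rw [Prod.dist_eq, max_lt_iff, dist_zero_right] at hdist
  obtain ⟨hw₀n, hzd⟩ := hdist
  have hw₀1 : ‖w₀‖ < (1 / 8 : ℝ) ^ m₀ := lt_of_lt_of_le hw₀n (min_le_right _ _)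
  have hzδ : dist z y₀ < δ := lt_of_lt_of_le hzd ((min_le_left _ _).trans (min_le_left _ _))
  have hz1 : dist z y₀ < 1 := lt_of_lt_of_le hzd ((min_le_left _ _).trans (min_le_right _ _))
  rw [dist_zero_right]
  -- (4) the dyadic depth `m` of `w₀`: `1 < 8^m |w₀| ≤ 8`, and `m₀ < m`
  have hw₀pos : 0 < ‖w₀‖ := norm_pos_iff.2 hw₀
  have hw₀le1 : ‖w₀‖ ≤ 1 := hw₀1.le.trans (pow_le_one₀ (by norm_num) (by norm_num))
  obtain ⟨k, hk1, hk2⟩ := exists_nat_pow_near (one_le_inv_iff₀.2 ⟨hw₀pos, hw₀le1⟩)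
    (by norm_num : (1 : ℝ) < 8)
  set m : ℕ := k + 1 with hm
  have hinv : ‖w₀‖⁻¹ * ‖w₀‖ = 1 := inv_mul_cancel₀ hw₀pos.ne'
  have hm1 : 1 < (8 : ℝ) ^ m * ‖w₀‖ := by
    have := mul_lt_mul_of_pos_right hk2 hw₀pos
    rwa [hinv] at this
  have hm8 : (8 : ℝ) ^ m * ‖w₀‖ ≤ 8 := by
    have h' : (8 : ℝ) ^ k * ‖w₀‖ ≤ 1 := by
      have := mul_le_mul_of_nonneg_right hk1 hw₀pos.le
      rwa [hinv] at this
    rw [hm, pow_succ]; nlinarith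
  have hm₀m : m₀ < m := by
    have h1 : (8 : ℝ) ^ m₀ < ‖w₀‖⁻¹ := by
      rw [one_div, inv_pow] at hw₀1
      exact (lt_inv_comm₀ hw₀pos (by positivity)).1 hw₀1
    have h2 : (8 : ℝ) ^ m₀ < 8 ^ m := h1.trans hk2
    exact (pow_lt_pow_iff_right₀ (by norm_num : (1 : ℝ) < 8)).1 h2
  have hhalf : (1 / 2 : ℝ) ^ m < (1 / 2 : ℝ) ^ m₀ :=
    pow_lt_pow_right_of_lt_one₀ (by norm_num) (by norm_num) hm₀m
  -- (5) the dilation `M (w, z) = (8^m • w, z)` and `K = K_m ∘ M`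
  set c : ℝ := (8 : ℝ) ^ m with hc
  have hc1 : 1 ≤ c := one_le_pow₀ (by norm_num)
  have hc0 : c ≠ 0 := by positivity
  have hcpos : 0 < c := by positivity
  set M : (ℝ × P) ≃L[ℝ] (ℝ × P) := ContinuousLinearEquiv.equivOfInverse
    (ContinuousLinearMap.prodMap (c • ContinuousLinearMap.id ℝ ℝ) (ContinuousLinearMap.id ℝ P))
    (ContinuousLinearMap.prodMap (c⁻¹ • ContinuousLinearMap.id ℝ ℝ) (ContinuousLinearMap.id ℝ P))
    (fun q => by ext <;> simp [Prod.map, hc0]) (fun q => by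
      ext <;> simp [Prod.map, hc0]) with hM
  have hMapply : ∀ q : ℝ × P, M q = (c • q.1, q.2) := fun q => rfl
  have hMnorm : ‖(M : (ℝ × P) →L[ℝ] (ℝ × P))‖ ≤ c := by
    refine ContinuousLinearMap.opNorm_le_bound _ (by positivity) fun q => ?_
    rw [ContinuousLinearEquiv.coe_coe, hMapply, Prod.norm_def, Prod.norm_def, norm_smul,
      Real.norm_of_nonneg (by positivity : (0 : ℝ) ≤ c)]
    refine max_le ?_ ?_
    · exact mul_le_mul_of_nonneg_left (le_max_left _ _) (by positivity)
    · calc ‖q.2‖ = 1 * ‖q.2‖ := (one_mul _).symm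
        _ ≤ c * max ‖q.1‖ ‖q.2‖ := mul_le_mul hc1 (le_max_right _ _) (norm_nonneg _) (by positivity)
  set Km : ℝ × P → E := fun q => K (c⁻¹ • q.1, q.2) with hKm
  have hKM : K = Km ∘ M := by
    funext q
    simp only [hKm, Function.comp_apply, hMapply, smul_smul, inv_mul_cancel₀ hc0, one_smul]
  set y : ℝ × P := M (w₀, z) with hy
  have hy1 : y.1 = c • w₀ := rfl
  have hy2 : y.2 = z := rfl
  have hy1n : ‖y.1‖ = c * ‖w₀‖ := by
    rw [hy1, norm_smul, Real.norm_of_nonneg (by positivity)]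
  -- `‖Dⁿ K (w₀, z)‖ ≤ ‖Dⁿ K_m y‖ · c ^ n`
  have hstep1 : ‖iteratedFDeriv ℝ n K (w₀, z)‖ ≤ ‖iteratedFDeriv ℝ n Km y‖ * c ^ n := by
    have h := M.iteratedFDerivWithin_comp_right Km uniqueDiffOn_univ (mem_univ (M (w₀, z))) n
    rw [Set.preimage_univ, iteratedFDerivWithin_univ, iteratedFDerivWithin_univ, ← hKM] at h
    rw [h]
    refine (ContinuousMultilinearMap.norm_compContinuousLinearMap_le _ _).trans ?_
    rw [Finset.prod_const, Finset.card_univ, Fintype.card_fin]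
    exact mul_le_mul_of_nonneg_left (pow_le_pow_left₀ (norm_nonneg _) hMnorm n) (norm_nonneg _)
  -- (6) the contraction `L (w, z) = (2^{-m} • w, z)` and the flatness of `f ∘ L` on cube roots
  set L : (ℝ × P) →L[ℝ] (ℝ × P) := ContinuousLinearMap.prodMap
    (((2 : ℝ) ^ m)⁻¹ • ContinuousLinearMap.id ℝ ℝ) (ContinuousLinearMap.id ℝ P) with hL
  have hLapply : ∀ q : ℝ × P, L q = (((2 : ℝ) ^ m)⁻¹ • q.1, q.2) := fun q => rfl
  have h2m : ((2 : ℝ) ^ m)⁻¹ = (1 / 2 : ℝ) ^ m := by rw [one_div, inv_pow]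
  have h2m1 : ((2 : ℝ) ^ m)⁻¹ ≤ 1 := by rw [h2m]; exact pow_le_one₀ (by norm_num) (by norm_num)
  have hLnorm : ‖L‖ ≤ 1 := by
    refine ContinuousLinearMap.opNorm_le_bound _ zero_le_one fun q => ?_
    rw [hLapply, Prod.norm_def, Prod.norm_def, norm_smul, one_mul,
      Real.norm_of_nonneg (by positivity : (0 : ℝ) ≤ ((2 : ℝ) ^ m)⁻¹)]
    refine max_le ((mul_le_of_le_one_left (norm_nonneg _) h2m1).trans (le_max_left _ _))
      (le_max_right _ _)
  have hg : ContDiff ℝ ∞ (f ∘ L) := hf.comp L.contDiff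
  set Cm : ℝ := C * (2 * (1 / 2 : ℝ) ^ m) ^ (3 * n + 1) with hCm
  -- flatness of `f ∘ L` at any cube root `ξ` of `y.1` (paired with `z`)
  have hflatL : ∀ ξ : ℝ, ξ ^ 3 = y.1 → ∀ i ≤ n,
      ‖iteratedFDerivWithin ℝ i (f ∘ L) univ (ξ, z)‖ ≤ Cm := by
    intro ξ hξ i hi
    have hξ2 : ‖ξ‖ ≤ 2 := abs_le_two_of_abs_pow_three_le (by rw [hξ, hy1n]; exact hm8)
    rw [iteratedFDerivWithin_univ,
      L.iteratedFDeriv_comp_right hf _ (by exact_mod_cast le_top : (i : ℕ∞ω) ≤ ∞)]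
    refine (ContinuousMultilinearMap.norm_compContinuousLinearMap_le _ _).trans ?_
    rw [Finset.prod_const, Finset.card_univ, Fintype.card_fin]
    have hL1 : ‖L‖ ^ i ≤ 1 := pow_le_one₀ (norm_nonneg _) hLnorm
    have hpt : dist (L (ξ, z)) (0, y₀) < δ := by
      rw [hLapply, Prod.dist_eq, dist_zero_right, norm_smul,
        Real.norm_of_nonneg (by positivity : (0 : ℝ) ≤ ((2 : ℝ) ^ m)⁻¹), h2m]
      refine max_lt ?_ hzδ
      calc (1 / 2 : ℝ) ^ m * ‖ξ‖ ≤ (1 / 2 : ℝ) ^ m * 2 :=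
            mul_le_mul_of_nonneg_left hξ2 (by positivity)
        _ < (1 / 2 : ℝ) ^ m₀ * 2 := by gcongr
        _ < δ / 2 * 2 := by gcongr
        _ = δ := by ring
    have hfl := hCδ i hi (L (ξ, z)) hpt
    have hn1 : ‖(L (ξ, z)).1‖ ≤ 2 * (1 / 2 : ℝ) ^ m := by
      rw [hLapply, norm_smul, Real.norm_of_nonneg (by positivity : (0 : ℝ) ≤ ((2 : ℝ) ^ m)⁻¹),
        h2m, mul_comm]
      exact mul_le_mul_of_nonneg_right hξ2 (by positivity)
    calc ‖iteratedFDeriv ℝ i f (L (ξ, z))‖ * ‖L‖ ^ i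
        ≤ ‖iteratedFDeriv ℝ i f (L (ξ, z))‖ * 1 := mul_le_mul_of_nonneg_left hL1 (norm_nonneg _)
      _ ≤ C * ‖(L (ξ, z)).1‖ ^ (3 * n + 1) := by rw [mul_one]; exact hfl
      _ ≤ Cm := by
          rw [hCm]
          exact mul_le_mul_of_nonneg_left (pow_le_pow_left₀ (norm_nonneg _) hn1 _) hC0
  -- (7) the chain-rule bound through ONE branch
  have hbranch : ∀ (ψ : ℝ → ℝ) (s : Set (ℝ × P)), IsOpen s →
      ContDiffOn ℝ ∞ (fun q : ℝ × P => (ψ q.1, q.2)) s → (∀ q ∈ s, ψ q.1 ^ 3 = q.1) → y ∈ s →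
      (∀ i, 1 ≤ i → i ≤ n →
        ‖iteratedFDerivWithin ℝ i (fun q : ℝ × P => (ψ q.1, q.2)) s y‖ ≤ D ^ i) →
      ‖iteratedFDeriv ℝ n Km y‖ ≤ n.factorial * Cm * D ^ n := by
    intro ψ s hso hΨ hψ3 hys hDy
    -- `K_m` agrees with `(f ∘ L) ∘ Ψ` near `y`
    have heq : Km =ᶠ[𝓝 y] ((f ∘ L) ∘ fun q : ℝ × P => (ψ q.1, q.2)) := by
      filter_upwards [hso.mem_nhds hys] with q hq
      simp only [hKm, Function.comp_apply, hLapply]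
      -- both sides are `f` at a point whose first coordinate cubes to `c⁻¹ • q.1`
      have hcube : (((2 : ℝ) ^ m)⁻¹ • ψ q.1) ^ 3 = c⁻¹ • q.1 := by
        rw [smul_eq_mul, smul_eq_mul, mul_pow, hψ3 q hq, hc, ← inv_pow, ← inv_pow, ← pow_mul,
          mul_comm m 3, pow_mul]
        norm_num
      rw [hK (((2 : ℝ) ^ m)⁻¹ • ψ q.1) q.2, hcube]
    rw [(heq.iteratedFDeriv ℝ n).eq_of_nhds, ← iteratedFDerivWithin_of_isOpen n hso hys]
    exact norm_iteratedFDerivWithin_comp_le hg.contDiffOn hΨ (by exact_mod_cast le_top)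
      uniqueDiffOn_univ hso.uniqueDiffOn (mapsTo_univ _ _) hys
      (fun i hi => hflatL (ψ y.1) (hψ3 y hys) i hi) hDy
  -- (8) pick the branch whose shell contains `y`
  have hDy : ‖iteratedFDeriv ℝ n Km y‖ ≤ n.factorial * Cm * D ^ n := by
    have hyann : 1 ≤ ‖y.1‖ ∧ ‖y.1‖ ≤ 8 := ⟨by rw [hy1n]; exact hm1.le, by rw [hy1n]; exact hm8⟩
    have hyz : dist y.2 y₀ ≤ 1 := by rw [hy2]; exact hz1.le
    by_cases hsgn : 0 ≤ y.1
    · have hyQ : y ∈ Q₀ := by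
        refine ⟨⟨?_, ?_⟩, hyz⟩
        · change 1 ≤ y.1; rw [Real.norm_of_nonneg hsgn] at hyann; exact hyann.1
        · change y.1 ≤ 8; rw [Real.norm_of_nonneg hsgn] at hyann; exact hyann.2
      refine hbranch (fun w => w ^ ((3 : ℝ)⁻¹)) s₀ hs₀o hΨ₀s
        (fun q hq => rpow_third_pow_three_of_pos hq) (hQ₀s hyQ)
        fun i hi1 hin => (hD₀ y hyQ i hi1 hin).trans ?_
      exact pow_le_pow_left₀ (zero_le_one.trans hD₀1) (le_max_left _ _) i
    · have hneg : y.1 ≤ 0 := le_of_lt (lt_of_not_ge hsgn)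
      have hyQ : y ∈ Q₁ := by
        refine ⟨⟨?_, ?_⟩, hyz⟩
        · change y.1 ≤ -1; rw [Real.norm_of_nonpos hneg] at hyann; linarith [hyann.1]
        · change -8 ≤ y.1; rw [Real.norm_of_nonpos hneg] at hyann; linarith [hyann.2]
      refine hbranch (fun w => -((-w) ^ ((3 : ℝ)⁻¹))) s₁ hs₁o hΨ₁s
        (fun q hq => neg_rpow_third_neg_pow_three hq) (hQ₁s hyQ)
        fun i hi1 hin => (hD₁ y hyQ i hi1 hin).trans ?_
      exact pow_le_pow_left₀ (zero_le_one.trans hD₁1) (le_max_right _ _) i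
  -- (9) arithmetic: `c ^ n · n! · Cm · D ^ n = A · (1/2)^m < ε`
  have hexp : c ^ n * ((1 / 2 : ℝ) ^ m) ^ (3 * n + 1) = (1 / 2 : ℝ) ^ m := by
    have h1 : ((1 / 2 : ℝ) ^ m) ^ 3 = (1 / 8 : ℝ) ^ m := by rw [← pow_mul, mul_comm, pow_mul]; norm_num
    have h2 : c * (1 / 8 : ℝ) ^ m = 1 := by rw [hc, ← mul_pow]; norm_num
    calc c ^ n * ((1 / 2 : ℝ) ^ m) ^ (3 * n + 1)
        = c ^ n * ((((1 / 2 : ℝ) ^ m) ^ 3) ^ n * (1 / 2 : ℝ) ^ m) := by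
          rw [pow_succ, pow_mul]
      _ = (c * (1 / 8 : ℝ) ^ m) ^ n * (1 / 2 : ℝ) ^ m := by rw [h1, mul_pow]; ring
      _ = (1 / 2 : ℝ) ^ m := by rw [h2, one_pow, one_mul]
  have hfinal : ‖iteratedFDeriv ℝ n K (w₀, z)‖ ≤ A * (1 / 2 : ℝ) ^ m := by
    calc ‖iteratedFDeriv ℝ n K (w₀, z)‖ ≤ ‖iteratedFDeriv ℝ n Km y‖ * c ^ n := hstep1
      _ ≤ n.factorial * Cm * D ^ n * c ^ n := mul_le_mul_of_nonneg_right hDy (by positivity)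
      _ = A * (c ^ n * ((1 / 2 : ℝ) ^ m) ^ (3 * n + 1)) := by rw [hA, hCm, mul_pow]; ring
      _ = A * (1 / 2 : ℝ) ^ m := by rw [hexp]
  calc ‖iteratedFDeriv ℝ n K (w₀, z)‖ ≤ A * (1 / 2 : ℝ) ^ m := hfinal
    _ ≤ A * (ε / (A + 1)) := mul_le_mul_of_nonneg_left (hhalf.le.trans hm₀ε.le) hA0
    _ < ε := by rw [mul_div_assoc', div_lt_iff₀ (by positivity)]; nlinarith

end Key

end Literature.Analysis.Calculus

end
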